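import Summits.QuantumFields.BalabanUV.Beta.D1BFx.RestKernelGhostUnit

/-!
# `BalabanUV.Beta.D1BFx.RestKernelGhostUnitRow` — road «BF-x» for binder row D1, slot (K), DICT-CHAIN-SPEC §2 (II) row RK-GH, «RK-GH-UNIT» FILE 4b:
# **ONE n-FREE CONSTANT FOR ALL TWELVE GHOST REST WORDS: `|secondMoment (ghostWordK (Ggh n a) (Pgt n a) 𝒱 𝒲 i) μ ν| ≤ KU(a)·n⁻²`**
# (companion of FILE 4 `RestKernelGhostUnit`, split off by the 400-line rule)

HONEST DEPENDENCY (cell records, verbatim): «continuum YM on T⁴ ⇐ BetaPertH ∧ nine spine estimates (0/9 proved); BetaPertH ⇐ (D1) ∧ (D4) ∧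
CAP+tail; G-an2-4 gates asym, D1 and NE2/3/4.»  HONEST FRAMING (cell contract, verbatim): «discharging `BetaPertH` makes Bałaban's UV stability
UNCONDITIONAL — a real constructive-QFT result; it is NOT the continuum limit and NOT the Clay problem.»  THIS MODULE DISCHARGES NOTHING of the
wall: [folklore] real-number bookkeeping over FILE 4's six class letters (`decay510_word_tadpole` ∕ `_single_none` ∕ `_single_some` ∕ `_double_self` ∕ `_double_mixed`)
and `abs_secondMoment_le` (`B12Sec2to5.secondMoment_abs_le_of_decay510`).  UNCONDITIONAL (`0 < a` only); no `def`, no `def … : Prop`, nothing cited, 0 sorry.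
IT IS the RK-GH unit row (`hRu`∕`hU` with `Ru := secondMoment`, `CU′ := 0`, `CU := KU(a)`, n-uniform since `n⁻² ≤ 1`) for the twelve ghost members of the (K) row's
pointwise dictionary; 0 root-level binders of row D1 discharged (hW ∕ hR-sockets ∕ hSX-socket ∕ D1Tel ∕ D1Rep — 0); (K) NOT closed; NOT D1, NOT `BetaPertH`,
NOT continuum, NOT Clay.

ABSOLUTE RULE (cell charter, verbatim): «No internally-minted statement may enter as a cited fact. Every hypothesis is either kernel-proved in
this package or a verbatim quotation of a PUBLISHED theorem with page reference. The manuscript(s) under audit are NOT citable for their own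
disputed steps — they are the thing under adjudication; programme-internal (2001/route/tribunal) claims are never citable.»

CONTENT: **`abs_secondMoment_ghostWordK_le (ha : 0 < a) (i : GhIdx) (μ ν : Fin 4) : |secondMoment (…) μ ν| ≤ KU(a)·((m+1)²)⁻¹`** with
`KU(a) := ½·(cPPs·MG·CW·M(κ′∕8) + ((SG·MG + SG + KPG)·(cPPs·e^{δ_PP} + cPPs·MG + MG·cPPs) + cPPs·e^{δ_PP}·MG·cPPs·MG)·CV²·M(σ₀))` — a generous n-free sum
dominating the six class constants of FILE 4's table (`M(δ) := Σ'_x |x|₁²e^{−δ|x|₁}`; `SG, MG, KPG, CV, CW` as there); `abs_secondMoment_ghostWordK_le_unit` (`≤ KU(a)`).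
Unit `b2b-balaban-beta-d1-formalise-leaf-04` (gen 18), D1 formalisation swarm leaf prover 04, road «BF-x»; INTENT 1 «RK-GH-UNIT» FILE 4b (journal).
-/

noncomputable section

open Finset
open scoped BigOperators
open Literature.MathematicalPhysics.QuantumFieldTheory.Balaban1983to89
open Literature.MathematicalPhysics.QuantumFieldTheory.Balaban1983to89.Beta
open B12Sec2to5 (l1 l1_nonneg Decay510)
open B4Sect5Proof (latticeConst latticeConst_nonneg)
open B5Hk163Strip (kappa163 kappa163_pos)
open B5Hk163Decay (MG163)
open B4TorusKernel (periodConst)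
open ExpKernelCalculus (Site MKer)
open Summit.QuantumFields.BalabanUV.Beta.D1BFx.RProjector (Pgt deltaPP deltaPP_pos)
open Summit.QuantumFields.BalabanUV.Beta.D1BFx.ProjectorSupNorm (cPPs cPPs_nonneg)
open Summit.QuantumFields.BalabanUV.Beta.D1BFx.GhostLeg (Ggh const_nonneg)
open Summit.QuantumFields.BalabanUV.Beta.D1BFx.GhostLegFree (ghDelta ghDelta_pos)
open Summit.QuantumFields.BalabanUV.Beta.D1BFx.GhostLegBlockMass (cNear)
open Summit.QuantumFields.BalabanUV.Beta.D1BFx.RColumnBlockMass (cNear_nonneg)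
open Summit.QuantumFields.BalabanUV.Beta.D1BFx.GhostStencil (ghCur)
open Summit.QuantumFields.BalabanUV.Beta.D1BFx.TorusGhostPairStencils (gh₂)
open Summit.QuantumFields.BalabanUV.Beta.D1BFx.ReducedKernelF (vertexRedF)
open Summit.QuantumFields.BalabanUV.Beta.D1BFx.ReducedTableF (tableRedF)
open Summit.QuantumFields.BalabanUV.Beta.D1BFx.RestKernelGhostWords (GhIdx ghostWordK)
open Summit.QuantumFields.BalabanUV.Beta.D1BFx.RestKernelGhostUnit

namespace Summit.QuantumFields.BalabanUV.Beta.D1BFx.RestKernelGhostUnitRow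

variable (m : ℕ) {a : ℝ}


/-! ## §1 The arithmetic of the six class constants (atoms only) -/

section Arith

variable {N SPc MGc SG EP KPG CV CW MT MS : ℝ}

/-- [folklore] Tadpoles: `½·(SP∕N⁴·MG·(CW·(N⁴)⁻¹))·MT ≤ ½·(SP·MG·CW·MT + R)·N⁻²` for `N ≥ 1`, `R ≥ 0`. -/
theorem arith_tadpole {R : ℝ} (hN : 1 ≤ N) (hSPc : 0 ≤ SPc) (hMGc : 0 ≤ MGc) (hCW : 0 ≤ CW) (hMT : 0 ≤ MT) (hR : 0 ≤ R) :
    (1 / 2) * (SPc / N ^ 4 * MGc * (CW * (N ^ 4)⁻¹)) * MT ≤ (1 / 2) * (SPc * MGc * CW * MT + R) * (N ^ 2)⁻¹ := by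
  have hN0 : 0 < N := by linarith
  have hx : (N ^ 4)⁻¹ * (N ^ 2)⁻¹ ≤ 1 := by
    calc (N ^ 4)⁻¹ * (N ^ 2)⁻¹ ≤ 1 * 1 :=
          mul_le_mul (inv_le_one_of_one_le₀ (one_le_pow₀ hN)) (inv_le_one_of_one_le₀ (one_le_pow₀ hN)) (by positivity) zero_le_one
      _ = 1 := one_mul 1
  have e : (1 / 2) * (SPc / N ^ 4 * MGc * (CW * (N ^ 4)⁻¹)) * MT = (1 / 2) * (SPc * MGc * CW * MT) * (N ^ 2)⁻¹ * ((N ^ 4)⁻¹ * (N ^ 2)⁻¹) := by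
    field_simp
  rw [e]
  have h0 : 0 ≤ (1 / 2) * (SPc * MGc * CW * MT) * (N ^ 2)⁻¹ := by positivity
  calc (1 / 2) * (SPc * MGc * CW * MT) * (N ^ 2)⁻¹ * ((N ^ 4)⁻¹ * (N ^ 2)⁻¹) ≤ (1 / 2) * (SPc * MGc * CW * MT) * (N ^ 2)⁻¹ * 1 :=
        mul_le_mul_of_nonneg_left hx h0
    _ ≤ (1 / 2) * (SPc * MGc * CW * MT + R) * (N ^ 2)⁻¹ := by
        rw [mul_one]
        exact mul_le_mul_of_nonneg_right (mul_le_mul_of_nonneg_left (by linarith) (by norm_num)) (by positivity)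

/-- [folklore] Bubbles with no extra power: `½·Y·CV²·MS·N²·N⁻⁴ ≤ ½·(T + Spart·CV²·MS)·N⁻²` when `0 ≤ Y ≤ Spart`, `T ≥ 0`. -/
theorem arith_bubble {Y T Spart : ℝ} (hN : 1 ≤ N) (hYle : Y ≤ Spart) (hT : 0 ≤ T) (hMS : 0 ≤ MS) :
    (1 / 2) * (Y * CV ^ 2 * MS) * (N ^ 2)⁻¹ ≤ (1 / 2) * (T + Spart * CV ^ 2 * MS) * (N ^ 2)⁻¹ := by
  have hN0 : 0 < N := by linarith
  refine mul_le_mul_of_nonneg_right (mul_le_mul_of_nonneg_left ?_ (by norm_num)) (by positivity)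
  have h1 : Y * CV ^ 2 * MS ≤ Spart * CV ^ 2 * MS := mul_le_mul_of_nonneg_right (mul_le_mul_of_nonneg_right hYle (by positivity)) hMS
  linarith

/-- [folklore] `(G∘G, P)`: rearrangement `½·((SG·MG)·(SP∕N⁴·EP)·(CV·N)·(CV·N))·MS = ½·(((SG·MG)·(SP·EP))·CV²·MS)·N⁻²`. -/
theorem arith_none (hN : 1 ≤ N) :
    (1 / 2) * ((SG * MGc) * (SPc / N ^ 4 * EP) * (CV * N) * (CV * N)) * MS = (1 / 2) * (((SG * MGc) * (SPc * EP)) * CV ^ 2 * MS) * (N ^ 2)⁻¹ := by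
  have hN0 : 0 < N := by linarith
  field_simp

/-- [folklore] `(G, P∘G)` ∕ `(G, G∘P)`: `½·(SG·(SP∕N⁴·MG)·(CV·N)·(CV·N))·MS = ½·((SG·(SP·MG))·CV²·MS)·N⁻²`. -/
theorem arith_some (hN : 1 ≤ N) :
    (1 / 2) * (SG * (SPc / N ^ 4 * MGc) * (CV * N) * (CV * N)) * MS = (1 / 2) * ((SG * (SPc * MGc)) * CV ^ 2 * MS) * (N ^ 2)⁻¹ := by
  have hN0 : 0 < N := by linarith
  field_simp

/-- [folklore] self double-`P`: `½·(KPG·(SP∕N⁴·MG)·(CV·N)·(CV·N))·MS = ½·((KPG·(SP·MG))·CV²·MS)·N⁻²`. -/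
theorem arith_self (hN : 1 ≤ N) :
    (1 / 2) * (KPG * (SPc / N ^ 4 * MGc) * (CV * N) * (CV * N)) * MS = (1 / 2) * ((KPG * (SPc * MGc)) * CV ^ 2 * MS) * (N ^ 2)⁻¹ := by
  have hN0 : 0 < N := by linarith
  field_simp

/-- [folklore] mixed double-`P`: `½·((SP∕N⁴·EP)·(MG·(SP∕N⁴·MG))·(CV·N)·(CV·N))·MS ≤ ½·((SP·EP·(MG·(SP·MG)))·CV²·MS)·N⁻²` (the extra `(N⁴)⁻¹ ≤ 1`). -/
theorem arith_mixed (hN : 1 ≤ N) (hSPc : 0 ≤ SPc) (hMGc : 0 ≤ MGc) (hEP : 0 ≤ EP) (hMS : 0 ≤ MS) :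
    (1 / 2) * ((SPc / N ^ 4 * EP) * (MGc * (SPc / N ^ 4 * MGc)) * (CV * N) * (CV * N)) * MS
      ≤ (1 / 2) * ((SPc * EP * (MGc * (SPc * MGc))) * CV ^ 2 * MS) * (N ^ 2)⁻¹ := by
  have hN0 : 0 < N := by linarith
  have e : (1 / 2) * ((SPc / N ^ 4 * EP) * (MGc * (SPc / N ^ 4 * MGc)) * (CV * N) * (CV * N)) * MS
      = (1 / 2) * ((SPc * EP * (MGc * (SPc * MGc))) * CV ^ 2 * MS) * (N ^ 2)⁻¹ * (N ^ 4)⁻¹ := by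
    field_simp
  rw [e]
  have h0 : 0 ≤ (1 / 2) * ((SPc * EP * (MGc * (SPc * MGc))) * CV ^ 2 * MS) * (N ^ 2)⁻¹ := by positivity
  calc (1 / 2) * ((SPc * EP * (MGc * (SPc * MGc))) * CV ^ 2 * MS) * (N ^ 2)⁻¹ * (N ^ 4)⁻¹
      ≤ (1 / 2) * ((SPc * EP * (MGc * (SPc * MGc))) * CV ^ 2 * MS) * (N ^ 2)⁻¹ * 1 :=
        mul_le_mul_of_nonneg_left (inv_le_one_of_one_le₀ (one_le_pow₀ hN)) h0
    _ = _ := mul_one _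

/-- [folklore] The generous sum dominates each product of one `A`-term and one `B`-term. -/
theorem prod_le_Spart {A B Asum Bsum X : ℝ} (hA : 0 ≤ A) (hAle : A ≤ Asum) (hBle : B ≤ Bsum) (hB : 0 ≤ B) (hX : 0 ≤ X) :
    A * B ≤ Asum * Bsum + X := by
  have h1 : A * B ≤ Asum * Bsum := mul_le_mul hAle hBle hB (hA.trans hAle)
  linarith

end Arith

/-! ## §2 The row: every word's second moment is `O(n⁻²)` uniformly in `n` -/

section Rows

variable (ha : 0 < a)
include ha

/-- [folklore] **THE RK-GH UNIT ROWS, ONE n-FREE CONSTANT**: for every `n = m + 1`, `i : GhIdx`, `μ ν`,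
`|secondMoment (ghostWordK (Ggh n a) (Pgt n a) 𝒱 𝒲 i) μ ν| ≤ KU(a)·n⁻²` (`KU(a)` displayed in the statement; see the module docstring). -/
theorem abs_secondMoment_ghostWordK_le (i : GhIdx) (μ ν : Fin 4) :
    |B12Beta.secondMoment (ghostWordK (Ggh (m + 1) a) (Pgt (m + 1) a) (fun κ u => (((m + 1 : ℕ) : ℝ) ^ 2) • vertexRedF (m + 1) (fun κ u => ghCur κ u) κ u) (fun κ u l u' => (((m + 1 : ℕ) : ℝ) ^ 2) • tableRedF (m + 1) (fun κ u l u' => if u = u' ∧ κ = l then gh₂ κ u else 0) κ u l u') i) μ ν|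
      ≤ (1 / 2) * ((cPPs 4 a * (cNear a * latticeConst 4 (ghDelta a))
            * (32 * ((MG163 (3 + 1) * periodConst (kappa163 (3 + 1)) 3) * Real.exp (kappa163 (3 + 1) / (3 + 1))) ^ 2 * (1 + 16 / (kappa163 (3 + 1) / (3 + 1))) ^ 4)
            * ∑' x : Site 4, l1 x ^ 2 * Real.exp (-(kappa163 (3 + 1) / (3 + 1) / 8) * l1 x))
          + (((2 / min 2 a * (cNear a * latticeConst 4 (ghDelta a)) + 2 / min 2 a
                + cPPs 4 a * Real.exp (deltaPP 4 a) * (2 / min 2 a) * (1 + 16 / deltaPP 4 a) ^ 4)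
              * (cPPs 4 a * Real.exp (deltaPP 4 a) + cPPs 4 a * (cNear a * latticeConst 4 (ghDelta a)) + (cNear a * latticeConst 4 (ghDelta a)) * cPPs 4 a)
              + cPPs 4 a * Real.exp (deltaPP 4 a) * ((cNear a * latticeConst 4 (ghDelta a)) * (cPPs 4 a * (cNear a * latticeConst 4 (ghDelta a)))))
            * (8 * Real.exp (kappa163 (3 + 1) / (3 + 1) / 16) * (MG163 (3 + 1) * periodConst (kappa163 (3 + 1)) 3) * Real.exp (kappa163 (3 + 1) / (3 + 1))
                * (1 + 16 / (kappa163 (3 + 1) / (3 + 1))) ^ 4) ^ 2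
            * ∑' x : Site 4, l1 x ^ 2 * Real.exp (-(min (deltaPP 4 a / 8) (kappa163 (3 + 1) / (3 + 1) / 16)) * l1 x)))
        * ((((m + 1 : ℕ) : ℝ)) ^ 2)⁻¹ := by
  obtain ⟨-, -, -, -, -, hσ0⟩ := sigma_facts m ha
  have hn : (1 : ℝ) ≤ ((m + 1 : ℕ) : ℝ) := by exact_mod_cast Nat.le_add_left 1 m
  have hκ8 : 0 < kappa163 (3 + 1) / (3 + 1) / 8 := by have := kappa163_pos (3 + 1); positivity
  -- nonnegativity of the letters
  have hSPc : 0 ≤ cPPs 4 a := cPPs_nonneg 4 ha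
  have hMGc : 0 ≤ cNear a * latticeConst 4 (ghDelta a) := mul_nonneg (cNear_nonneg ha) (latticeConst_nonneg 4 (ghDelta_pos ha).le)
  have hSG : 0 ≤ 2 / min 2 a := const_nonneg a ha
  have hEP : 0 ≤ Real.exp (deltaPP 4 a) := (Real.exp_pos _).le
  have hKPG : 0 ≤ cPPs 4 a * Real.exp (deltaPP 4 a) * (2 / min 2 a) * (1 + 16 / deltaPP 4 a) ^ 4 := by
    have := deltaPP_pos 4 ha; positivity
  have hK4 : 0 ≤ MG163 (3 + 1) * periodConst (kappa163 (3 + 1)) 3 := by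
    have h := GhostWordJetLetters.wH_const_nonneg m
    have hpos : (0 : ℝ) < ((((m + 1 : ℕ) : ℝ)) ^ (3 + 2))⁻¹ := by positivity
    have h2 := (mul_nonneg_iff_of_pos_right (Real.exp_pos (kappa163 (3 + 1) / (3 + 1)))).1 h
    exact (mul_nonneg_iff_of_pos_left hpos).1 h2
  have hκ : 0 < kappa163 (3 + 1) / (3 + 1) := by have := kappa163_pos (3 + 1); positivity
  have hCW : 0 ≤ 32 * ((MG163 (3 + 1) * periodConst (kappa163 (3 + 1)) 3) * Real.exp (kappa163 (3 + 1) / (3 + 1))) ^ 2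
      * (1 + 16 / (kappa163 (3 + 1) / (3 + 1))) ^ 4 := by positivity
  have hMT : 0 ≤ ∑' x : Site 4, l1 x ^ 2 * Real.exp (-(kappa163 (3 + 1) / (3 + 1) / 8) * l1 x) := momentSum_nonneg _
  have hMS : 0 ≤ ∑' x : Site 4, l1 x ^ 2 * Real.exp (-(min (deltaPP 4 a / 8) (kappa163 (3 + 1) / (3 + 1) / 16)) * l1 x) := momentSum_nonneg _
  have hT : 0 ≤ cPPs 4 a * (cNear a * latticeConst 4 (ghDelta a))
      * (32 * ((MG163 (3 + 1) * periodConst (kappa163 (3 + 1)) 3) * Real.exp (kappa163 (3 + 1) / (3 + 1))) ^ 2 * (1 + 16 / (kappa163 (3 + 1) / (3 + 1))) ^ 4)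
      * ∑' x : Site 4, l1 x ^ 2 * Real.exp (-(kappa163 (3 + 1) / (3 + 1) / 8) * l1 x) := by positivity
  have hX : 0 ≤ cPPs 4 a * Real.exp (deltaPP 4 a) * ((cNear a * latticeConst 4 (ghDelta a)) * (cPPs 4 a * (cNear a * latticeConst 4 (ghDelta a)))) := by
    positivity
  have hAsum : 0 ≤ 2 / min 2 a * (cNear a * latticeConst 4 (ghDelta a)) + 2 / min 2 a
      + cPPs 4 a * Real.exp (deltaPP 4 a) * (2 / min 2 a) * (1 + 16 / deltaPP 4 a) ^ 4 := by positivity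
  have hBsum : 0 ≤ cPPs 4 a * Real.exp (deltaPP 4 a) + cPPs 4 a * (cNear a * latticeConst 4 (ghDelta a))
      + (cNear a * latticeConst 4 (ghDelta a)) * cPPs 4 a := by positivity
  have hSpart : 0 ≤ (2 / min 2 a * (cNear a * latticeConst 4 (ghDelta a)) + 2 / min 2 a
        + cPPs 4 a * Real.exp (deltaPP 4 a) * (2 / min 2 a) * (1 + 16 / deltaPP 4 a) ^ 4)
      * (cPPs 4 a * Real.exp (deltaPP 4 a) + cPPs 4 a * (cNear a * latticeConst 4 (ghDelta a)) + (cNear a * latticeConst 4 (ghDelta a)) * cPPs 4 a)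
      + cPPs 4 a * Real.exp (deltaPP 4 a) * ((cNear a * latticeConst 4 (ghDelta a)) * (cPPs 4 a * (cNear a * latticeConst 4 (ghDelta a)))) := by
    positivity
  have hSM : 0 ≤ 2 / min 2 a * (cNear a * latticeConst 4 (ghDelta a)) := mul_nonneg hSG hMGc
  have hPE : 0 ≤ cPPs 4 a * Real.exp (deltaPP 4 a) := mul_nonneg hSPc hEP
  have hPM : 0 ≤ cPPs 4 a * (cNear a * latticeConst 4 (ghDelta a)) := mul_nonneg hSPc hMGc
  have hMP : 0 ≤ (cNear a * latticeConst 4 (ghDelta a)) * cPPs 4 a := mul_nonneg hMGc hSPc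
  rcases i with b | ⟨π, t⟩ | b | b
  · -- tadpoles
    refine (abs_secondMoment_le hκ8 (decay510_word_tadpole m ha b μ ν)).trans ?_
    exact arith_tadpole hn hSPc hMGc hCW hMT (by positivity)
  · rcases π with _ | t'
    · refine (abs_secondMoment_le hσ0 (decay510_word_single_none m ha t μ ν)).trans ?_
      rw [arith_none hn]
      exact arith_bubble hn (prod_le_Spart (by positivity) (by linarith) (by linarith) (by positivity) hX) hT hMS
    · cases t'
      · refine (abs_secondMoment_le hσ0 (decay510_word_single_some m ha false t μ ν)).trans ?_
        rw [arith_some hn]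
        exact arith_bubble hn (prod_le_Spart hSG (by linarith) (by linarith) (by positivity) hX) hT hMS
      · refine (abs_secondMoment_le hσ0 (decay510_word_single_some m ha true t μ ν)).trans ?_
        rw [arith_some hn]
        exact arith_bubble hn (prod_le_Spart hSG (by linarith) (by linarith) (by positivity) hX) hT hMS
  · refine (abs_secondMoment_le hσ0 (decay510_word_double_self m ha b μ ν)).trans ?_
    rw [arith_self hn]
    exact arith_bubble hn (prod_le_Spart hKPG (by linarith) (by linarith) (by positivity) hX) hT hMS
  · refine ((abs_secondMoment_le hσ0 (decay510_word_double_mixed m ha b μ ν)).trans (arith_mixed hn hSPc hMGc hEP hMS)).trans ?_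
    refine arith_bubble hn ?_ hT hMS
    have h1 : 0 ≤ (2 / min 2 a * (cNear a * latticeConst 4 (ghDelta a)) + 2 / min 2 a
          + cPPs 4 a * Real.exp (deltaPP 4 a) * (2 / min 2 a) * (1 + 16 / deltaPP 4 a) ^ 4)
        * (cPPs 4 a * Real.exp (deltaPP 4 a) + cPPs 4 a * (cNear a * latticeConst 4 (ghDelta a)) + (cNear a * latticeConst 4 (ghDelta a)) * cPPs 4 a) :=
      mul_nonneg hAsum hBsum
    linarith

/-- [folklore] … hence the plain n-UNIFORM unit row (`n⁻² ≤ 1`): `|secondMoment (…) μ ν| ≤ KU(a)`. -/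
theorem abs_secondMoment_ghostWordK_le_unit (i : GhIdx) (μ ν : Fin 4) :
    |B12Beta.secondMoment (ghostWordK (Ggh (m + 1) a) (Pgt (m + 1) a) (fun κ u => (((m + 1 : ℕ) : ℝ) ^ 2) • vertexRedF (m + 1) (fun κ u => ghCur κ u) κ u) (fun κ u l u' => (((m + 1 : ℕ) : ℝ) ^ 2) • tableRedF (m + 1) (fun κ u l u' => if u = u' ∧ κ = l then gh₂ κ u else 0) κ u l u') i) μ ν|
      ≤ (1 / 2) * ((cPPs 4 a * (cNear a * latticeConst 4 (ghDelta a))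
            * (32 * ((MG163 (3 + 1) * periodConst (kappa163 (3 + 1)) 3) * Real.exp (kappa163 (3 + 1) / (3 + 1))) ^ 2 * (1 + 16 / (kappa163 (3 + 1) / (3 + 1))) ^ 4)
            * ∑' x : Site 4, l1 x ^ 2 * Real.exp (-(kappa163 (3 + 1) / (3 + 1) / 8) * l1 x))
          + (((2 / min 2 a * (cNear a * latticeConst 4 (ghDelta a)) + 2 / min 2 a
                + cPPs 4 a * Real.exp (deltaPP 4 a) * (2 / min 2 a) * (1 + 16 / deltaPP 4 a) ^ 4)
              * (cPPs 4 a * Real.exp (deltaPP 4 a) + cPPs 4 a * (cNear a * latticeConst 4 (ghDelta a)) + (cNear a * latticeConst 4 (ghDelta a)) * cPPs 4 a)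
              + cPPs 4 a * Real.exp (deltaPP 4 a) * ((cNear a * latticeConst 4 (ghDelta a)) * (cPPs 4 a * (cNear a * latticeConst 4 (ghDelta a)))))
            * (8 * Real.exp (kappa163 (3 + 1) / (3 + 1) / 16) * (MG163 (3 + 1) * periodConst (kappa163 (3 + 1)) 3) * Real.exp (kappa163 (3 + 1) / (3 + 1))
                * (1 + 16 / (kappa163 (3 + 1) / (3 + 1))) ^ 4) ^ 2
            * ∑' x : Site 4, l1 x ^ 2 * Real.exp (-(min (deltaPP 4 a / 8) (kappa163 (3 + 1) / (3 + 1) / 16)) * l1 x))) := by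
  have h := abs_secondMoment_ghostWordK_le m ha i μ ν
  have hn : (1 : ℝ) ≤ ((m + 1 : ℕ) : ℝ) := by exact_mod_cast Nat.le_add_left 1 m
  have hN2 : ((((m + 1 : ℕ) : ℝ)) ^ 2)⁻¹ ≤ 1 := inv_le_one_of_one_le₀ (one_le_pow₀ hn)
  have hMGc : 0 ≤ cNear a * latticeConst 4 (ghDelta a) := mul_nonneg (cNear_nonneg ha) (latticeConst_nonneg 4 (ghDelta_pos ha).le)
  have hSPc : 0 ≤ cPPs 4 a := cPPs_nonneg 4 ha
  have hδ := deltaPP_pos 4 ha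
  have hκ : 0 < kappa163 (3 + 1) / (3 + 1) := by have := kappa163_pos (3 + 1); positivity
  have hMT : 0 ≤ ∑' x : Site 4, l1 x ^ 2 * Real.exp (-(kappa163 (3 + 1) / (3 + 1) / 8) * l1 x) := momentSum_nonneg _
  have hMS : 0 ≤ ∑' x : Site 4, l1 x ^ 2 * Real.exp (-(min (deltaPP 4 a / 8) (kappa163 (3 + 1) / (3 + 1) / 16)) * l1 x) := momentSum_nonneg _
  refine h.trans (mul_le_of_le_one_right ?_ hN2)
  positivity

end Rows

end Summit.QuantumFields.BalabanUV.Beta.D1BFx.RestKernelGhostUnitRow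

end
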